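import Summits.NavierStokesRegularity.NavierStokesRegularity.Theses.TerminalTrace
import Summits.NavierStokesRegularity.NavierStokesRegularity.Theorems.TraceDensityCriterion.Negative.LoadBearing
import HarnessLib.Audit

/-!
# BC3 birth skeleton of the crux `TerminalTrace.TraceDensityCriterion`

(crux item `stmt-NavierStokesRegularity-18614`, rank 2 of route `route-NavierStokesRegularity-TerminalTrace`;
line `birth` = tree path `Cruxes/TraceDensityCriterion/Lines/birth.lean`; registrar
`planner-skel-stmt-NavierStokesRegularity-18614-0`, 2026-08-17. The crux is the cone-repair retyping
(rev 1) of the retired stmt-18380, whose birth skeleton lived as evidence on that item only.)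

THE CRUX (fixed; decl `Summit.NavierStokesRegularity.NavierStokesRegularity.Theses.TerminalTrace.TraceDensityCriterion`).
Frame: `ν > 0`, `T > 0`, `(u, p)` classical on `[0, T) × ℝ³`, Leray–Hopf on `[0, T]` from the rapidly
decaying datum `u 0`. If the final value `u T` has no scaled-energy concentration at `x₀`,
FE(x₀): `r⁻¹ ∫_{B(x₀,r)} ‖u T x‖² → 0` as `r → 0⁺`, then `u` is bounded on some backward cylinder
`(T − r², T) × B(x₀, r)` (verbatim `IsBackwardBoundedAt u T x₀`, `Negative.crux_iff_isBackwardBoundedAt`):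
Seregin–Šverák 2002 Thm 2.2 (tree: `SereginSverak2002.isBackwardBoundedAt_top_of_scaledEnergy_at`)
with its one-sided pressure / head hypothesis `hone` DELETED.

THE CUT (k = 2, along the Albritton–Barker scaled kinetic energy `cknA r (T, x₀) u =
sup_{T−r²<t<T} r⁻¹ ∫_{B(x₀,r)} ‖u t‖²` at the vertex — the route header's "by_cases on the cknA bound",
with the non-Morrey cell typed POSITIVELY):

* `stub_morrey_cell` [L; = the route's support item `MorreyCellCriterion`, stmt-NavierStokesRegularity-18615,
  BY NAME] — the COMPACT (Type-I-energy) CELL of the criterion: frame ∧ `limsup_{r→0} cknA r (T,x₀) u < ∞`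
  ∧ FE(x₀) ⇒ backward bounded at `(T, x₀)`. Known in kind: the SS2002 discharge path of the tree
  (`exists_blowup_limit_at_vertex` → weak vanishing of every vertex blow-up limit at its final time from FE,
  `tendsto_lintegral_ball_zoom_of_scaledEnergy` / `ae_abs_pairing_le_near_top_of_scaledEnergy` →
  `isBackwardBoundedAt_top_of_weakVanishing`: zero extension across `s = 0` + CKN), with the Morrey bound
  replacing `hone` as the source of compactness of the zooms, of the Morrey bound of the limit
  (`blowupLimit_window_ball_le`) and of the time-modulus of pairings (`zoom_pairing_modulus`); largeness on
  final windows from ε-regularity at a singular vertex instead of the pressure probe. The small-`M` sub-cell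
  (`limsup cknA < ε₀`) is plain ε-regularity in the `L^∞_t L²_x` scaled norm (Gustafson–Kang–Tsai 2007,
  Thm 1.1 with `(p, q) = (2, ∞)`); the content is the LARGE-`M` cell (qualitative Type-I cell,
  Albritton–Barker 2019 / Barker–Prange 2021 Prop 4.1 twin).
* `stub_traceForcesMorrey` [XL; OPEN — the load-bearing stub] — the A-PRIORI half: in the frame, FE(x₀)
  FORCES the Type-I scaled-energy bound backward in time, `∃ M r₀, ∀ r ∈ (0, r₀), cknA r (T, x₀) u ≤ M`
  (conclusion literally the Morrey hypothesis of `MorreyCellCriterion`). Contrapositive reading: a point of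
  NON-Type-I energy concentration at the first singular time (`cknA r_k → ∞` along `r_k → 0`) scars the
  final value — its scaled `L²` density at `x₀` does not vanish. This is the route header's foreseen child
  `NonMorreyCellCriterion` ("frame ∧ ¬Morrey ∧ FE ⇒ backward bounded") re-typed so that its conclusion does
  not deny its own hypothesis: backward boundedness forces `cknA r ≤ C²|B₁| r² → 0`, so the by_cases child is
  equivalent — modulo that elementary estimate — to the implication stated here, and strictly WEAKER than
  the crux (crux ⇒ backward bounded ⇒ Morrey bound). No mechanism in print (2001 census 4.5: a
  'self-cleaning' Type-II cascade with unbounded scaled energy before `T` and a density-free final value is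
  exactly what it must exclude).

`compose` is the kernel-checked composition in HYPOTHESES FORM (`<stub₁ sig> → <stub₂ sig> → <crux body>`,
no `sorry`, axioms ⊆ {propext, Classical.choice, Quot.sound}); `TraceDensityCriterion_of` is the ONLY
declaration of this file concluding the crux BY NAME (the skeleton audit admits only named obligations as
hypotheses of the crux-concluding theorem, so the by-name form applies the two stubs to `compose`).

Disproof used: no `Disproof.lean` on file for stmt-18614 (`ledger crux ls`, 2026-08-17T13:3xZ). Landed
negative lemmas `Theorems/TraceDensityCriterion/Negative/LoadBearing.lean` (refuter, p143279) are imported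
and honoured: `crux_false_without_lerayHopf` — BOTH stubs keep the clause `IsLerayHopfOn T ν 0 (u 0) u`
(the KNSS drift `u = −log(1−t)e₀` has `cknA r (1, x₀) u = ∞` for every `r`, so it sits in the NON-Morrey
cell: `stub_traceForcesMorrey` minus Leray–Hopf is false by the same witness, `stub_morrey_cell` minus
Leray–Hopf is vacuous on it); `not_crux_normal_form` — a counterexample to either stub is still a first-time
blow-up from a rapidly decaying datum (for `stub_traceForcesMorrey`: one with non-Type-I energy
concentration AND a density-free trace at the same point). Neither stub is an instance of a refuted
statement (`ledger negatives`: the route's only retired decls 18380/18383 were restated, not refuted).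

BC3 probes (this registrar, farm `lean check`, files `bc/probe_stub_morrey_cell.lean`,
`bc/probe_stub_traceForcesMorrey.lean`, attached as evidence): for each stub, `stub → TraceDensityCriterion`
and `stub → NavierStokesRegularity` by the literal battery `first | exact? | simpa | aesop` FAIL (4/4: `exact?`
and `simpa` throw, `aesop` "failed to prove the goal after exhaustive search", example ends `unsolved goals`);
the unfolded variants `simpa [defs]` and `unfold defs; aesop` FAIL as well (8/8). No stub is cheaply the crux
or the summit; conversely the crux implies each stub (pieces are weaker: `stub_morrey_cell` by dropping its
Morrey hypothesis, `stub_traceForcesMorrey` via backward bounded ⇒ `cknA r ≤ C²|B₁|r²`).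
-/

noncomputable section

open Set Filter Topology MeasureTheory Metric

namespace Summit.NavierStokesRegularity.NavierStokesRegularity.Cruxes.TraceDensityCriterion.Birth

set_option linter.unusedVariables false
set_option linter.dupNamespace false

/-! ### The two registered stubs -/

/-- **stub — `stub_morrey_cell`** (L; = support item `MorreyCellCriterion`, stmt-NavierStokesRegularity-18615,
BY NAME). The compact (Type-I-energy) cell of the criterion: in the frame, if the scaled kinetic energy
`cknA r (T, x₀) u` stays bounded as `r → 0⁺` and FE(x₀) holds, then `(T, x₀)` is backward bounded.
Seregin–Šverák 2002 §4 with the Morrey bound in place of the one-sided pressure hypothesis (compact zooms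
⇒ vertex blow-up limit; FE ⇒ the limit vanishes weakly at its final time; zero extension + CKN / backward
uniqueness ⇒ the vertex is regular). Why it might fail: only if the `hone`-free compactness/largeness steps
of the tree files need more than `limsup cknA < ∞` (Seregin 2007: a bound on `A` alone bounds `C, D, E`
for suitable weak solutions — expected to suffice). -/
theorem stub_morrey_cell : Theses.TerminalTrace.MorreyCellCriterion := by
  sorry

/-- **stub — `stub_traceForcesMorrey`** (XL; OPEN — load-bearing). In the frame, a point `x₀` where the
final value has vanishing scaled `L²` density (FE(x₀)) is a point of AT MOST Type-I energy concentration: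
`∃ M r₀, ∀ r ∈ (0, r₀), cknA r (T, x₀) u ≤ M`. Equivalently: non-Type-I concentration of the scaled kinetic
energy at a first-time singular point leaves a residue in the final value's `L²` density. Strictly weaker
than the crux (backward bounded ⇒ `cknA r → 0`); positive re-typing of the route's foreseen
`NonMorreyCellCriterion`. Why it might fail: a tail-free ('self-cleaning') Type-II collapse whose debris
radiates away before `T` would have unbounded `cknA` and a density-free trace (2001 census 4.5; no
mechanism in print either way). Sources: SereginSverak2002 §4; Seregin2007CriticalMorreyEstimates;
AlbrittonBarker2019 (arXiv:1811.00502) Thm 1.1 / Rem 3.2; BarkerPrange2021 Prop 4.1; arXiv:2510.20757 §1.2. -/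
theorem stub_traceForcesMorrey :
    ∀ (ν T : ℝ), 0 < ν → 0 < T →
      ∀ (u : ℝ → EuclideanSpace ℝ (Fin 3) → EuclideanSpace ℝ (Fin 3)) (p : ℝ → EuclideanSpace ℝ (Fin 3) → ℝ),
      Literature.Analysis.FluidPDE.IsClassicalNSSolutionOn (Set.Ico 0 T) ν 0 u p →
      Literature.Analysis.FluidPDE.IsLerayHopfOn T ν 0 (u 0) u →
      Literature.Analysis.FluidPDE.HasRapidSpatialDecay (u 0) →
      ∀ x₀ : EuclideanSpace ℝ (Fin 3),
        Filter.Tendsto (fun r : ℝ => r⁻¹ * ∫ x in Metric.ball x₀ r, ‖u T x‖ ^ 2)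
          (nhdsWithin 0 (Set.Ioi 0)) (nhds 0) →
        ∃ (M : NNReal) (r₀ : ℝ), 0 < r₀ ∧
          ∀ r : ℝ, 0 < r → r < r₀ → Literature.Analysis.FluidPDE.cknA r (T, x₀) u ≤ M := by
  sorry

/-! ### The composition (closed): Morrey cell + FE-forces-Morrey ⇒ the crux -/

/-- **Composition, hypotheses form** (CLOSED, no `sorry`): the compact-cell criterion and the a-priori
Morrey bound from FE give the crux — written with the crux body UNFOLDED (so that
`TraceDensityCriterion_of` below is the file's only by-name conclusion). At a point `x₀` with FE(x₀) the
second hypothesis supplies the Morrey bound at the vertex `(T, x₀)`, and the first turns Morrey bound + FE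
into backward boundedness. -/
theorem compose (hcell : Theses.TerminalTrace.MorreyCellCriterion)
    (hforce : ∀ (ν T : ℝ), 0 < ν → 0 < T →
      ∀ (u : ℝ → EuclideanSpace ℝ (Fin 3) → EuclideanSpace ℝ (Fin 3)) (p : ℝ → EuclideanSpace ℝ (Fin 3) → ℝ),
      Literature.Analysis.FluidPDE.IsClassicalNSSolutionOn (Set.Ico 0 T) ν 0 u p →
      Literature.Analysis.FluidPDE.IsLerayHopfOn T ν 0 (u 0) u →
      Literature.Analysis.FluidPDE.HasRapidSpatialDecay (u 0) →
      ∀ x₀ : EuclideanSpace ℝ (Fin 3),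
        Filter.Tendsto (fun r : ℝ => r⁻¹ * ∫ x in Metric.ball x₀ r, ‖u T x‖ ^ 2)
          (nhdsWithin 0 (Set.Ioi 0)) (nhds 0) →
        ∃ (M : NNReal) (r₀ : ℝ), 0 < r₀ ∧
          ∀ r : ℝ, 0 < r → r < r₀ → Literature.Analysis.FluidPDE.cknA r (T, x₀) u ≤ M) :
    ∀ (ν T : ℝ), 0 < ν → 0 < T →
      ∀ (u : ℝ → EuclideanSpace ℝ (Fin 3) → EuclideanSpace ℝ (Fin 3)) (p : ℝ → EuclideanSpace ℝ (Fin 3) → ℝ),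
      Literature.Analysis.FluidPDE.IsClassicalNSSolutionOn (Set.Ico 0 T) ν 0 u p →
      Literature.Analysis.FluidPDE.IsLerayHopfOn T ν 0 (u 0) u →
      Literature.Analysis.FluidPDE.HasRapidSpatialDecay (u 0) →
      ∀ x₀ : EuclideanSpace ℝ (Fin 3),
        Filter.Tendsto (fun r : ℝ => r⁻¹ * ∫ x in Metric.ball x₀ r, ‖u T x‖ ^ 2)
          (nhdsWithin 0 (Set.Ioi 0)) (nhds 0) →
        ∃ r > 0, ∃ C : ℝ, ∀ t ∈ Set.Ioo (T - r ^ 2) T, ∀ x ∈ Metric.ball x₀ r, ‖u t x‖ ≤ C :=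
  fun ν T hν hT u p hcl hLH hdec x₀ hFE =>
    hcell ν T hν hT u p hcl hLH hdec x₀ (hforce ν T hν hT u p hcl hLH hdec x₀ hFE) hFE

/-! ### The skeleton: the crux BY NAME, modulo the two registered stubs -/

/-- **The line skeleton** (by-name form): `TraceDensityCriterion` from `stub_morrey_cell` and
`stub_traceForcesMorrey` through the closed composition `compose`. This is the ONLY declaration of the
file concluding the crux; it inherits exactly the two stubs' placeholders. -/
theorem TraceDensityCriterion_of : Theses.TerminalTrace.TraceDensityCriterion :=
  compose stub_morrey_cell stub_traceForcesMorrey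

end Summit.NavierStokesRegularity.NavierStokesRegularity.Cruxes.TraceDensityCriterion.Birth
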